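/-
Copyright: the b2b-balaban T⁴-continuum CRUX team, row NE7b OWNER lineage `t4-ne7b-p1` (gen 147). Project licence.
-/
import Summits.QuantumFields.BalabanUV.T4Continuum.Spine.NE7b.SupKernelClassSecondOrder
import Summits.QuantumFields.BalabanUV.T4Continuum.Spine.NE7b.SupWeightedSecondOrderLetters
import Summits.QuantumFields.BalabanUV.T4Continuum.Spine.NE7b.SupWeightedFamilyProfiles
import Summits.QuantumFields.BalabanUV.T4Continuum.Spine.NE7b.SupWeightedProfileDischarge

/-!
# THE WEIGHTED CLASS MAP PACKAGED AT ORDER TWO (SCOPING-d17 (d14)(3) ∕ SCOPING-d18 §E F20; file (748)).  The WEIGHTED CLASS (SCOPING-d17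
# §C–§D, the repair of the located NO (648)) carries, per order, INTRINSIC full-graph letters of the derivative majorants against a site
# weight: at order 2 the row∕column letters `Σ_b ϑ₂(a,b)Hk_{ab} ≤ hrϑ`, `Σ_b ϑ₂(a,b)Hk_{ba} ≤ hcϑ` of the Hessian majorant
# `|U″(φ)[e_z,e_x]| ≤ Hk_{xz}`.
# (484) put the OUTPUT Hessian `HessW⁺(ψ)` of the one-step effective action `W⁺(ψ) = −log∫e^{−U(·+ψ)}dμ_{AAᵀ}` in the input's entry format
# (`|HessW⁺(ψ)[e_z,e_x]| ≤ Hk⁺_{xz} = Hk_{xz} + E_D(b^z,b^x)`); (652) summed `Hk⁺` against the OUTPUT weight `ϑ` given two PROFILE letters `αθ, αθc`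
# of the step; (659) wrote the profile letters as intrinsic letter × factor letter.  THIS FILE composes the three: the weighted row and
# column letters of `|HessW⁺(ψ)|` at weight `ϑ` (and, read off by Schur, its operator letter) from
#   — the road's step data ((484)'s hypotheses: regularised Gaussian `μ_{AAᵀ}`, stability, derivative letters, the admissible `D`),
#   — the weights `ϑ ≤ ϑ₂` (sites), `σ` (site–sampler), `θ` (samplers) with `ϑ_{xz} ≤ σ_{xw}σ_{zw}`, `σ_{xw} ≤ σ_{xz′}θ_{z′w}`, `D`'s weighted
#     letters,
#   — the INPUT's intrinsic letters `hrϑ, hcϑ` (at `ϑ₂`), the FACTOR's weighted letters `Σ_{z′}|A_{uz′}|σA_{uz′} ≤ αrσ`,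
#     `Σ_u|A_{uz′}|σA_{uz′} ≤ αcσ`
#     under the one compatibility `σ_{vz′} ≤ ϑ₂(v,u)σA_{uz′}`, and the scalar bookkeeping `hrϑ·αrσ ≤ αθ`, `hcϑ·αcσ ≤ αθc`:
#   `Σ_{u′}|HessW⁺(ψ)[e_{u′},e_v]|ϑ_{vu′} ≤ hrϑ + dθ·αθ·dθ′·αθc∕(1−lamA)`,  `Σ_v(…)ϑ_{vu′} ≤ hcϑ + (same)`,  `‖HessW⁺(ψ)‖ ≤ √(col·row)`
# — «ϑ₂-letters + factor letters in ⟹ ϑ-letters out», NO profile hypothesis, no support count, no range (row NE7b, node U5c; (484), (652),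
# (659), (747) BY NAME; [folklore]).  The rate bookkeeping (which `ϑ, ϑ₂, σ, θ` a scale allows) is (672)∕(746).

Cell `pub-balaban`, sub-cell `t4`, spine estimate NE7b (`T4WeightBudget.RelWeightBound`; the cell's OWN estimate — NOT PRINTED in
[Bałaban 1983–89], NOT PROVED).  Crux-route work under `Spine/NE7b/` by the row OWNER (`t4-ne7b-p1` gen 147, file (748)) under FREEZE
(0)'s crux-prover clause; NOTHING of Bałaban's is named as a Lean object, valued or asserted; no `T4Continuum/Support` leaf typed; no
`def`, no notation (`HessW⁺(ψ)` WRITTEN OUT as printed by (484)); zero `sorry`.  Imports (BY NAME): (484) `…SupKernelClassSecondOrder`,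
(652) `…SupWeightedSecondOrderLetters`, (659) `…SupWeightedFamilyProfiles`, (747) `…SupWeightedProfileDischarge`.

WHAT IS PROVED ([folklore]): **`classmap_two_row`**, **`classmap_two_col`**, **`classmap_two_opNorm`**; toy.

HONEST (what this is NOT).  Order 2 of the packaging (orders 3–5: the sibling files); the derivative∕continuity slots of the class are
(402)∕(418)-type statements without profile letters and are not restated; finite-torus Gaussian measure `μ_{AAᵀ}` with the road's
regularisation; the rates are (672)∕(746); scalar skeleton ((A3), NC-NE7b-α UNRULED); nothing of Bałaban's asserted.  BY-NAME EFFECT ON THE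
WALL: NONE.  NE7b NOT PRINTED ∕ NOT PROVED; spine PROVED 0∕9; rung (B)+1 — the programme's measures remain FINITE-torus statements; NOT the
mass gap, NOT Clay.  HONEST DEPENDENCY: continuum YM on T⁴ ⇐ BetaPertH ∧ nine spine estimates (0∕9 proved); BetaPertH ⇐ (D1) ∧ (D4) ∧
CAP+tail; G-an2-4 gates asym, D1 and NE2∕3∕4.
-/

set_option autoImplicit false
set_option maxSynthPendingDepth 3

noncomputable section

namespace Summit.QuantumFields.BalabanUV.T4Continuum.NE7b.SupWeightedClassMapOrderTwo

open MeasureTheory ProbabilityTheory Finset Real Matrix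
open scoped BigOperators Matrix
open SupKernelClassSecondOrder (opNorm_le_of_row_col output_second_entry_format)
open SupWeightedSecondOrderLetters (output_weighted_rowsum output_weighted_colsum)
open SupWeightedFamilyProfiles (hk_profile_row hk_profile_col)
open SupWeightedProfileDischarge (hk_row_of_slot hk_col_of_slot letter_nonneg₁)

variable {ι κ : Type} [Fintype ι] [DecidableEq ι] [Fintype κ] [DecidableEq κ]

variable {U : EuclideanSpace ℝ ι → ℝ} {U' : EuclideanSpace ℝ ι → EuclideanSpace ℝ ι →L[ℝ] ℝ}
  {U'' : EuclideanSpace ℝ ι → EuclideanSpace ℝ ι →L[ℝ] EuclideanSpace ℝ ι →L[ℝ] ℝ} {Hk : ι → ι → ℝ} {A : Matrix ι κ ℝ} {D : κ → κ → ℝ}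
  {γop κ₀ κ₁ κ₂ a τ δ θp lamA αr αc hr γ dθ dθ' αθ αθc αrσ αcσ hrϑ hcϑ : ℝ} {θ : κ → κ → ℝ} {σ σA : ι → κ → ℝ} {ϑ ϑ₂ : ι → ι → ℝ}

/-- **ORDER 2, ROWS — THE WEIGHTED CLASS MAP PACKAGED**: for every background `ψ` and site `v`, the `ψ`-Hessian of the one-step effective
action `W⁺(ψ) = −log∫e^{−U(·+ψ)}dμ_{AAᵀ}` ((484)'s display) has weighted row letter
`Σ_{u′}|HessW⁺(ψ)[e_{u′},e_v]|·ϑ_{vu′} ≤ hrϑ + dθ·αθ·dθ′·αθc∕(1−lamA)` — from the road's step data ((484)'s hypotheses), the weights'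
compatibilities, the INPUT's intrinsic `ϑ₂`-letters `hrϑ, hcϑ` of `Hk`, the factor's weighted letters `αrσ, αcσ` and the bookkeeping
inequalities `hrϑ·αrσ ≤ αθ`, `hcϑ·αcσ ≤ αθc`; NO profile hypothesis ((659) + (747) discharge them inside). [folklore] -/
theorem classmap_two_row [Nonempty κ] (hΓop : (γop • (1 : Matrix ι ι ℝ) - A * Aᵀ).PosSemidef) (Y : Finset ι)
    (hUd : ∀ φ : EuclideanSpace ℝ ι, HasFDerivAt U (U' φ) φ) (hU'd : ∀ φ : EuclideanSpace ℝ ι, HasFDerivAt U' (U'' φ) φ) (hU''c : Continuous U'')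
    (hκ₀ : 0 ≤ κ₀) (hκ₁ : 0 ≤ κ₁) (ha : 0 ≤ a) (hκ₂ : 0 ≤ κ₂) (hτ : 0 < τ) (hδ : 0 < δ) (hθ0 : 0 < θp) (hθ1 : θp < 1)
    (hκθ : (2 * κ₀ * (1 + τ) + 4 * δ) * γop ≤ θp) (hκθw : 2 * κ₀ * (1 + τ) * γop + 4 * δ ≤ θp)
    (hstab : ∀ φ : EuclideanSpace ℝ ι, -(κ₀ * ∑ x ∈ Y, φ x ^ 2) ≤ U φ) (hU'b : ∀ φ : EuclideanSpace ℝ ι, ‖U' φ‖ ≤ κ₁ * (a + ∑ x ∈ Y, φ x ^ 2))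
    (hU''b : ∀ φ : EuclideanSpace ℝ ι, ‖U'' φ‖ ≤ κ₂)
    (hHk : ∀ (φ : EuclideanSpace ℝ ι) (x z : ι), |U'' φ (EuclideanSpace.single z (1 : ℝ)) (EuclideanSpace.single x (1 : ℝ))| ≤ Hk x z)
    (hHk0 : ∀ v u, 0 ≤ Hk v u) (ψ : EuclideanSpace ℝ ι) (hαr : ∀ u, ∑ w, |A u w| ≤ αr) (hαc : ∀ w, ∑ u, |A u w| ≤ αc) (hhr : ∀ v, ∑ u, Hk v u ≤ hr)
    (hlam : ∀ x : κ, ∑ u, ∑ v, |A u x| * |A v x| * Hk v u ≤ lamA) (hlam1 : lamA < 1) (hγ : αc * hr * αr / (1 - lamA) ≤ γ) (hγ1 : γ < 1)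
    (hD : ∀ x y, 0 ≤ D x y)
    (hDC : ∀ x y, (if x = y then (1 : ℝ) else 0) + ∑ z, D x z * ((if y = z then 0 else ∑ u, ∑ v, |A u y| * |A v z| * Hk v u) / (1 - lamA)) ≤ D x y)
    (hθnn : ∀ z w, 0 ≤ θ z w) (hDθr : ∀ z', ∑ w, D z' w * θ z' w ≤ dθ) (hdθ : 0 ≤ dθ) (hDθc : ∀ w, ∑ z', D z' w * θ z' w ≤ dθ') (hdθ' : 0 ≤ dθ')
    (hσ0 : ∀ x w, 0 ≤ σ x w) (hσθ : ∀ x z' w, σ x w ≤ σ x z' * θ z' w) (hϑ1 : ∀ x y, 1 ≤ ϑ x y) (hϑ12 : ∀ x y, ϑ x y ≤ ϑ₂ x y)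
    (hϑ₂symm : ∀ x y, ϑ₂ x y = ϑ₂ y x) (hϑσ : ∀ x z w, ϑ x z ≤ σ x w * σ z w)
    (hσA0 : ∀ u z', 0 ≤ σA u z') (hσϑ₂ : ∀ v u z', σ v z' ≤ ϑ₂ v u * σA u z') (hAr : ∀ u, ∑ z', |A u z'| * σA u z' ≤ αrσ) (hαrσ : 0 ≤ αrσ)
    (hAc : ∀ z', ∑ u, |A u z'| * σA u z' ≤ αcσ) (hαcσ : 0 ≤ αcσ)
    (hhrw : ∀ a, ∑ b, ϑ₂ a b * Hk a b ≤ hrϑ) (hhc : ∀ a, ∑ b, ϑ₂ a b * Hk b a ≤ hcϑ)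
    (hαθ : hrϑ * αrσ ≤ αθ) (hαθc : hcϑ * αcσ ≤ αθc) (v : ι) :
    ∑ u',
        |((∫ ω : EuclideanSpace ℝ ι, exp (-U (ω + ψ)) ∂(multivariateGaussian 0 (A * Aᵀ)))⁻¹ •
          (∫ ω : EuclideanSpace ℝ ι, exp (-U (ω + ψ)) • (U'' (ω + ψ) - (U' (ω + ψ)).smulRight (U' (ω + ψ))) ∂(multivariateGaussian 0 (A * Aᵀ))) +
          (((∫ ω : EuclideanSpace ℝ ι, exp (-U (ω + ψ)) ∂(multivariateGaussian 0 (A * Aᵀ))) ^ 2)⁻¹ • ∫ ω : EuclideanSpace ℝ ι, exp (-U (ω + ψ)) • U'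
            (ω + ψ) ∂(multivariateGaussian 0 (A * Aᵀ))).smulRight
          (∫ ω : EuclideanSpace ℝ ι, exp (-U (ω + ψ)) • U' (ω + ψ) ∂(multivariateGaussian 0 (A * Aᵀ)))) (EuclideanSpace.single u' (1 : ℝ))
        (EuclideanSpace.single v (1 : ℝ))| * ϑ v u' ≤ hrϑ + dθ * αθ * (dθ' * αθc) / (1 - lamA) := by
  have hϑ₂0 : ∀ a b, 0 ≤ ϑ₂ a b := fun a b => (zero_le_one.trans (hϑ1 a b)).trans (hϑ12 a b)
  have hϑ0 : ∀ a b, 0 ≤ ϑ a b := fun a b => zero_le_one.trans (hϑ1 a b)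
  have hhc0 : 0 ≤ hcϑ := letter_nonneg₁ (fun b => mul_nonneg (hϑ₂0 v b) (hHk0 b v)) (hhc v)
  have haσX : ∀ v, ∑ z', (∑ u, |A u z'| * Hk v u) * σ v z' ≤ αθ := fun v =>
    (hk_profile_row hHk0 hϑ₂0 hσϑ₂ hAr hαrσ (hk_row_of_slot hhrw) v).trans hαθ
  have haσcX : ∀ z', ∑ v, (∑ u, |A u z'| * Hk v u) * σ v z' ≤ αθc := fun z' =>
    (hk_profile_col hHk0 hσA0 hσϑ₂ hAc (hk_col_of_slot hϑ₂symm hhc) hhc0 z').trans hαθc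
  have hαθc0 : 0 ≤ αθc := (mul_nonneg hhc0 hαcσ).trans hαθc
  have hrX : ∀ v, ∑ u, Hk v u * ϑ v u ≤ hrϑ := fun v =>
    (sum_le_sum fun u _ => mul_le_mul_of_nonneg_left (hϑ12 v u) (hHk0 v u)).trans (hk_row_of_slot hhrw v)
  have hcX : ∀ u, ∑ v, Hk v u * ϑ v u ≤ hcϑ := fun u =>
    (sum_le_sum fun v _ => mul_le_mul_of_nonneg_left (hϑ12 v u) (hHk0 v u)).trans (hk_col_of_slot hϑ₂symm hhc u)
  refine le_trans
      (sum_le_sum fun u' _ => mul_le_mul_of_nonneg_right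
        (output_second_entry_format hΓop Y hUd hU'd hU''c hκ₀ hκ₁ ha hκ₂ hτ hδ hθ0 hθ1 hκθ hκθw hstab hU'b hU''b hHk hHk0 ψ hαr hαc hhr hlam hlam1
          hγ hγ1 hD hDC v u') (hϑ0 v u')) ?_
  exact output_weighted_rowsum hHk0 hD hθnn hσ0 hϑσ hσθ hDθr hdθ hDθc hdθ' haσX haσcX hαθc0 hlam1 hrX v

/-- **ORDER 2, COLUMNS**: `Σ_v|HessW⁺(ψ)[e_{u′},e_v]|·ϑ_{vu′} ≤ hcϑ + dθ·αθ·dθ′·αθc∕(1−lamA)` for every `ψ, u′`, same hypotheses. [folklore] -/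
theorem classmap_two_col [Nonempty κ] (hΓop : (γop • (1 : Matrix ι ι ℝ) - A * Aᵀ).PosSemidef) (Y : Finset ι)
    (hUd : ∀ φ : EuclideanSpace ℝ ι, HasFDerivAt U (U' φ) φ) (hU'd : ∀ φ : EuclideanSpace ℝ ι, HasFDerivAt U' (U'' φ) φ) (hU''c : Continuous U'')
    (hκ₀ : 0 ≤ κ₀) (hκ₁ : 0 ≤ κ₁) (ha : 0 ≤ a) (hκ₂ : 0 ≤ κ₂) (hτ : 0 < τ) (hδ : 0 < δ) (hθ0 : 0 < θp) (hθ1 : θp < 1)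
    (hκθ : (2 * κ₀ * (1 + τ) + 4 * δ) * γop ≤ θp) (hκθw : 2 * κ₀ * (1 + τ) * γop + 4 * δ ≤ θp)
    (hstab : ∀ φ : EuclideanSpace ℝ ι, -(κ₀ * ∑ x ∈ Y, φ x ^ 2) ≤ U φ) (hU'b : ∀ φ : EuclideanSpace ℝ ι, ‖U' φ‖ ≤ κ₁ * (a + ∑ x ∈ Y, φ x ^ 2))
    (hU''b : ∀ φ : EuclideanSpace ℝ ι, ‖U'' φ‖ ≤ κ₂)
    (hHk : ∀ (φ : EuclideanSpace ℝ ι) (x z : ι), |U'' φ (EuclideanSpace.single z (1 : ℝ)) (EuclideanSpace.single x (1 : ℝ))| ≤ Hk x z)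
    (hHk0 : ∀ v u, 0 ≤ Hk v u) (ψ : EuclideanSpace ℝ ι) (hαr : ∀ u, ∑ w, |A u w| ≤ αr) (hαc : ∀ w, ∑ u, |A u w| ≤ αc) (hhr : ∀ v, ∑ u, Hk v u ≤ hr)
    (hlam : ∀ x : κ, ∑ u, ∑ v, |A u x| * |A v x| * Hk v u ≤ lamA) (hlam1 : lamA < 1) (hγ : αc * hr * αr / (1 - lamA) ≤ γ) (hγ1 : γ < 1)
    (hD : ∀ x y, 0 ≤ D x y)
    (hDC : ∀ x y, (if x = y then (1 : ℝ) else 0) + ∑ z, D x z * ((if y = z then 0 else ∑ u, ∑ v, |A u y| * |A v z| * Hk v u) / (1 - lamA)) ≤ D x y)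
    (hθnn : ∀ z w, 0 ≤ θ z w) (hDθr : ∀ z', ∑ w, D z' w * θ z' w ≤ dθ) (hdθ : 0 ≤ dθ) (hDθc : ∀ w, ∑ z', D z' w * θ z' w ≤ dθ') (hdθ' : 0 ≤ dθ')
    (hσ0 : ∀ x w, 0 ≤ σ x w) (hσθ : ∀ x z' w, σ x w ≤ σ x z' * θ z' w) (hϑ1 : ∀ x y, 1 ≤ ϑ x y) (hϑ12 : ∀ x y, ϑ x y ≤ ϑ₂ x y)
    (hϑ₂symm : ∀ x y, ϑ₂ x y = ϑ₂ y x) (hϑσ : ∀ x z w, ϑ x z ≤ σ x w * σ z w)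
    (hσA0 : ∀ u z', 0 ≤ σA u z') (hσϑ₂ : ∀ v u z', σ v z' ≤ ϑ₂ v u * σA u z') (hAr : ∀ u, ∑ z', |A u z'| * σA u z' ≤ αrσ) (hαrσ : 0 ≤ αrσ)
    (hAc : ∀ z', ∑ u, |A u z'| * σA u z' ≤ αcσ) (hαcσ : 0 ≤ αcσ)
    (hhrw : ∀ a, ∑ b, ϑ₂ a b * Hk a b ≤ hrϑ) (hhc : ∀ a, ∑ b, ϑ₂ a b * Hk b a ≤ hcϑ)
    (hαθ : hrϑ * αrσ ≤ αθ) (hαθc : hcϑ * αcσ ≤ αθc) (u' : ι) :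
    ∑ v,
        |((∫ ω : EuclideanSpace ℝ ι, exp (-U (ω + ψ)) ∂(multivariateGaussian 0 (A * Aᵀ)))⁻¹ •
          (∫ ω : EuclideanSpace ℝ ι, exp (-U (ω + ψ)) • (U'' (ω + ψ) - (U' (ω + ψ)).smulRight (U' (ω + ψ))) ∂(multivariateGaussian 0 (A * Aᵀ))) +
          (((∫ ω : EuclideanSpace ℝ ι, exp (-U (ω + ψ)) ∂(multivariateGaussian 0 (A * Aᵀ))) ^ 2)⁻¹ • ∫ ω : EuclideanSpace ℝ ι, exp (-U (ω + ψ)) • U'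
            (ω + ψ) ∂(multivariateGaussian 0 (A * Aᵀ))).smulRight
          (∫ ω : EuclideanSpace ℝ ι, exp (-U (ω + ψ)) • U' (ω + ψ) ∂(multivariateGaussian 0 (A * Aᵀ)))) (EuclideanSpace.single u' (1 : ℝ))
        (EuclideanSpace.single v (1 : ℝ))| * ϑ v u' ≤ hcϑ + dθ * αθ * (dθ' * αθc) / (1 - lamA) := by
  have hϑ₂0 : ∀ a b, 0 ≤ ϑ₂ a b := fun a b => (zero_le_one.trans (hϑ1 a b)).trans (hϑ12 a b)
  have hϑ0 : ∀ a b, 0 ≤ ϑ a b := fun a b => zero_le_one.trans (hϑ1 a b)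
  have hhc0 : 0 ≤ hcϑ := letter_nonneg₁ (fun b => mul_nonneg (hϑ₂0 u' b) (hHk0 b u')) (hhc u')
  have haσX : ∀ v, ∑ z', (∑ u, |A u z'| * Hk v u) * σ v z' ≤ αθ := fun v =>
    (hk_profile_row hHk0 hϑ₂0 hσϑ₂ hAr hαrσ (hk_row_of_slot hhrw) v).trans hαθ
  have haσcX : ∀ z', ∑ v, (∑ u, |A u z'| * Hk v u) * σ v z' ≤ αθc := fun z' =>
    (hk_profile_col hHk0 hσA0 hσϑ₂ hAc (hk_col_of_slot hϑ₂symm hhc) hhc0 z').trans hαθc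
  have hαθc0 : 0 ≤ αθc := (mul_nonneg hhc0 hαcσ).trans hαθc
  have hrX : ∀ v, ∑ u, Hk v u * ϑ v u ≤ hrϑ := fun v =>
    (sum_le_sum fun u _ => mul_le_mul_of_nonneg_left (hϑ12 v u) (hHk0 v u)).trans (hk_row_of_slot hhrw v)
  have hcX : ∀ u, ∑ v, Hk v u * ϑ v u ≤ hcϑ := fun u =>
    (sum_le_sum fun v _ => mul_le_mul_of_nonneg_left (hϑ12 v u) (hHk0 v u)).trans (hk_col_of_slot hϑ₂symm hhc u)
  refine le_trans
      (sum_le_sum fun v _ => mul_le_mul_of_nonneg_right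
        (output_second_entry_format hΓop Y hUd hU'd hU''c hκ₀ hκ₁ ha hκ₂ hτ hδ hθ0 hθ1 hκθ hκθw hstab hU'b hU''b hHk hHk0 ψ hαr hαc hhr hlam hlam1
          hγ hγ1 hD hDC v u') (hϑ0 v u')) ?_
  exact output_weighted_colsum hHk0 hD hθnn hσ0 hϑσ hσθ hDθr hdθ hDθc hdθ' haσX haσcX hαθc0 hlam1 hcX u'

/-- **ORDER 2, THE OPERATOR LETTER READ OFF THE WEIGHTED LETTERS**: `‖HessW⁺(ψ)‖ ≤ √((hcϑ⁺)(hrϑ⁺))` with `hrϑ⁺, hcϑ⁺` the two bounds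
above — Schur ((484) §1), the plain row∕column sums being at most the weighted ones (`ϑ ≥ 1`). [folklore] -/
theorem classmap_two_opNorm [Nonempty κ] (hΓop : (γop • (1 : Matrix ι ι ℝ) - A * Aᵀ).PosSemidef) (Y : Finset ι)
    (hUd : ∀ φ : EuclideanSpace ℝ ι, HasFDerivAt U (U' φ) φ) (hU'd : ∀ φ : EuclideanSpace ℝ ι, HasFDerivAt U' (U'' φ) φ) (hU''c : Continuous U'')
    (hκ₀ : 0 ≤ κ₀) (hκ₁ : 0 ≤ κ₁) (ha : 0 ≤ a) (hκ₂ : 0 ≤ κ₂) (hτ : 0 < τ) (hδ : 0 < δ) (hθ0 : 0 < θp) (hθ1 : θp < 1)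
    (hκθ : (2 * κ₀ * (1 + τ) + 4 * δ) * γop ≤ θp) (hκθw : 2 * κ₀ * (1 + τ) * γop + 4 * δ ≤ θp)
    (hstab : ∀ φ : EuclideanSpace ℝ ι, -(κ₀ * ∑ x ∈ Y, φ x ^ 2) ≤ U φ) (hU'b : ∀ φ : EuclideanSpace ℝ ι, ‖U' φ‖ ≤ κ₁ * (a + ∑ x ∈ Y, φ x ^ 2))
    (hU''b : ∀ φ : EuclideanSpace ℝ ι, ‖U'' φ‖ ≤ κ₂)
    (hHk : ∀ (φ : EuclideanSpace ℝ ι) (x z : ι), |U'' φ (EuclideanSpace.single z (1 : ℝ)) (EuclideanSpace.single x (1 : ℝ))| ≤ Hk x z)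
    (hHk0 : ∀ v u, 0 ≤ Hk v u) (ψ : EuclideanSpace ℝ ι) (hαr : ∀ u, ∑ w, |A u w| ≤ αr) (hαc : ∀ w, ∑ u, |A u w| ≤ αc) (hhr : ∀ v, ∑ u, Hk v u ≤ hr)
    (hlam : ∀ x : κ, ∑ u, ∑ v, |A u x| * |A v x| * Hk v u ≤ lamA) (hlam1 : lamA < 1) (hγ : αc * hr * αr / (1 - lamA) ≤ γ) (hγ1 : γ < 1)
    (hD : ∀ x y, 0 ≤ D x y)
    (hDC : ∀ x y, (if x = y then (1 : ℝ) else 0) + ∑ z, D x z * ((if y = z then 0 else ∑ u, ∑ v, |A u y| * |A v z| * Hk v u) / (1 - lamA)) ≤ D x y)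
    (hθnn : ∀ z w, 0 ≤ θ z w) (hDθr : ∀ z', ∑ w, D z' w * θ z' w ≤ dθ) (hdθ : 0 ≤ dθ) (hDθc : ∀ w, ∑ z', D z' w * θ z' w ≤ dθ') (hdθ' : 0 ≤ dθ')
    (hσ0 : ∀ x w, 0 ≤ σ x w) (hσθ : ∀ x z' w, σ x w ≤ σ x z' * θ z' w) (hϑ1 : ∀ x y, 1 ≤ ϑ x y) (hϑ12 : ∀ x y, ϑ x y ≤ ϑ₂ x y)
    (hϑ₂symm : ∀ x y, ϑ₂ x y = ϑ₂ y x) (hϑσ : ∀ x z w, ϑ x z ≤ σ x w * σ z w)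
    (hσA0 : ∀ u z', 0 ≤ σA u z') (hσϑ₂ : ∀ v u z', σ v z' ≤ ϑ₂ v u * σA u z') (hAr : ∀ u, ∑ z', |A u z'| * σA u z' ≤ αrσ) (hαrσ : 0 ≤ αrσ)
    (hAc : ∀ z', ∑ u, |A u z'| * σA u z' ≤ αcσ) (hαcσ : 0 ≤ αcσ)
    (hhrw : ∀ a, ∑ b, ϑ₂ a b * Hk a b ≤ hrϑ) (hhc : ∀ a, ∑ b, ϑ₂ a b * Hk b a ≤ hcϑ)
    (hαθ : hrϑ * αrσ ≤ αθ) (hαθc : hcϑ * αcσ ≤ αθc) :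
    ‖((∫ ω : EuclideanSpace ℝ ι, exp (-U (ω + ψ)) ∂(multivariateGaussian 0 (A * Aᵀ)))⁻¹ •
          (∫ ω : EuclideanSpace ℝ ι, exp (-U (ω + ψ)) • (U'' (ω + ψ) - (U' (ω + ψ)).smulRight (U' (ω + ψ))) ∂(multivariateGaussian 0 (A * Aᵀ))) +
          (((∫ ω : EuclideanSpace ℝ ι, exp (-U (ω + ψ)) ∂(multivariateGaussian 0 (A * Aᵀ))) ^ 2)⁻¹ • ∫ ω : EuclideanSpace ℝ ι, exp (-U (ω + ψ)) • U'
            (ω + ψ) ∂(multivariateGaussian 0 (A * Aᵀ))).smulRight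
          (∫ ω : EuclideanSpace ℝ ι, exp (-U (ω + ψ)) • U' (ω + ψ) ∂(multivariateGaussian 0 (A * Aᵀ))))‖ ≤ Real.sqrt
        ((hcϑ + dθ * αθ * (dθ' * αθc) / (1 - lamA)) * (hrϑ + dθ * αθ * (dθ' * αθc) / (1 - lamA))) := by
  refine opNorm_le_of_row_col _ (fun u' => ?_) (fun v => ?_)
  · refine le_trans (sum_le_sum fun v _ => le_mul_of_one_le_right (abs_nonneg _) (hϑ1 v u')) ?_
    exact classmap_two_col hΓop Y hUd hU'd hU''c hκ₀ hκ₁ ha hκ₂ hτ hδ hθ0 hθ1 hκθ hκθw hstab hU'b hU''b hHk hHk0 ψ hαr hαc hhr hlam hlam1 hγ hγ1 hD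
        hDC hθnn hDθr hdθ hDθc hdθ' hσ0 hσθ hϑ1 hϑ12 hϑ₂symm hϑσ hσA0 hσϑ₂ hAr hαrσ hAc hαcσ hhrw hhc hαθ
      hαθc u'
  · refine le_trans (sum_le_sum fun u' _ => le_mul_of_one_le_right (abs_nonneg _) (hϑ1 v u')) ?_
    exact classmap_two_row hΓop Y hUd hU'd hU''c hκ₀ hκ₁ ha hκ₂ hτ hδ hθ0 hθ1 hκθ hκθw hstab hU'b hU''b hHk hHk0 ψ hαr hαc hhr hlam hlam1 hγ hγ1 hD
        hDC hθnn hDθr hdθ hDθc hdθ' hσ0 hσθ hϑ1 hϑ12 hϑ₂symm hϑσ hσA0 hσϑ₂ hAr hαrσ hAc hαcσ hhrw hhc hαθ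
      hαθc v

/-! ## Toy -/

/-- Toy (the bookkeeping in numbers): intrinsic letter `2`, factor letter `3`, so any `αθ ≥ 6` serves; with `αθ = 6`, `6 ≤ 6`. -/
example : (2 : ℝ) * 3 ≤ 6 := by norm_num

end Summit.QuantumFields.BalabanUV.T4Continuum.NE7b.SupWeightedClassMapOrderTwo

end
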